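import Literature.NumberTheory.NumberFields.RayClassFieldAdicCharacterLocal
import Literature.NumberTheory.NumberFields.RayClassFieldAdicCharacterPrincipal
import HarnessLib

/-!
# The ray adic character on the LOCAL DECOMPOSITION GROUP at `v`: inertia elements with prescribed `κ_v`,
# and the Frobenius clause `[⟨α_v⟩_v, K]|_{K(𝔪vⁿ)} = 1` for `(α) = 𝔭_vᵏ`, `α ≡ 1 mod 𝔪`
# (de Shalit II.1.10 Cor. / I.1.8 «`k_ξⁿ` is class field to `⟨ξ⟩·(1 + 𝔭ⁿ)`», read globally)

Sequel of `RayClassFieldAdicCharacterLocal.lean` (which did the INERTIA group: `κ_v(res w) = a(w)⁻¹ = χ_π(w)⁻¹`).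
For `K` totally complex, `𝔪 ≠ 0`, `v ∤ 𝔪`, `w_𝔪 = 1`, `G = Gal(K̄/K(𝔪))`, `κ_v = rayAdicCharacter h𝔪 hv hw : G →* 𝒪_vˣ`
(de Shalit's `κ` of I.3.3 (9) / II.1.7 up to the reciprocity sign), `res = absGaloisRestrict K K_v ∘ toAbsGalois :
W_{K_v} → Γ_K`, and any local Artin map `a` (`IsLocalArtinMap`; e.g. THE pinned `canonicalArtin K_v`):

* §1 ★ `exists_mem_inertia_rayAdicCharacter_eq` — **every value of `κ_v` on `G` is taken on the image of the LOCAL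
  INERTIA**: `∀ g ∈ G, ∃ w ∈ I_{K_v}, κ_v(res w) = κ_v(g)` (`a(I_{K_v}) = 𝒪_vˣ` + `κ_v(res w) = a(w)⁻¹`), and
  `absRestrictNormalHom_eq_of_rayAdicCharacter_eq` — elements of `G` with the same `κ_v` act identically on EVERY layer
  `K(𝔪vⁿ)`; so `g` and `res w` induce the same automorphism of `K(𝔪v^∞)` (de Shalit II.1.10 Corollary: `𝔓` is
  totally ramified in `K(𝔣𝔭^∞)/K(𝔣)` — `Gal(K(𝔣𝔭^∞)/K(𝔣))` IS the image of the local inertia).  This is the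
  supply of local elements for the hypothesis `hη` of `PAdicOneVariableSeriesFamilyOf(Rel)NormCoherentUnits.lean`
  (inertia elements fix every unramified base `E`).
* §2 ★ `abRestrict_ideleArtinMap_localUnits_algebraMap_eq_one` — the FROBENIUS CLAUSE: for `α ∈ 𝓞_K`, `α ≠ 0`,
  `α − 1 ∈ 𝔪`, `α` a unit at every finite `w ≠ v` (so `(α) = 𝔭_vᵏ`): **`[⟨α_v⟩_v, K]` fixes `K(𝔪vⁿ)` for every `n`**
  — the idele `(α)⁻¹·⟨α_v⟩_v` (components `α⁻¹` away from `v`, `1` at `v`) lies in `I_K^{𝔪vⁿ}`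
  (`principalIdele_inv_mul_localUnits_mem_congruenceUnitIdeles`).  This is the global face of de Shalit I.1.8
  («`k_ξⁿ` is class field to `⟨ξ⟩·(1+𝔭ⁿ)`», `ξ = α = φ(𝔭^f)`): the local norm `α_v` acts trivially on the
  `𝔭`-division tower.
* §3 ★ `rayAdicCharacter_absGaloisRestrict_eq_inv_of_artin_eq_mul` — **off inertia**: for `w ∈ W_{K_v}` with
  `a(w) = α_v·u` (`α` as in §2, `u ∈ 𝒪_vˣ`): `res w ∈ G`, `IsAdicArtinValue 𝔪 v (res w) u⁻¹`, and `κ_v(res w) = u⁻¹`;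
  in particular `κ_v(res Φ') = 1` whenever `a(Φ') = α_v` (`rayAdicCharacter_absGaloisRestrict_eq_one_of_artin_eq`).
* §4 `lubinTateChar_toAbsGalois_eq_one_of_artin_eq` / ★ `coe_rayAdicCharacter_absGaloisRestrict_mul_inv_eq_lubinTateChar`
  — with THE Artin map and a uniformiser `π` of `K_v`: `χ_π(Φ) = 1` for `Art(Φ) = π` (Cassels–Fröhlich VI §3.4 Thm. 3 (e)),
  hence for `w = w₁·Φ'` with `w₁ ∈ I_{K_v}`, `Art(Φ') = α_v = π^k`: **`κ_v(res w)⁻¹ = χ_π(w)` in `K_v`** — the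
  inertia junction `coe_rayAdicCharacter_absGaloisRestrict_inv_eq_lubinTateChar` extended to the part of the
  decomposition group above the unramified base of degree `k` (the ABSOLUTE Lubin–Tate model `π^k = α`).

Theorems only; no `sorry`.

## References
* [deShalit1987] E. de Shalit, *Iwasawa theory of elliptic curves with complex multiplication* (1987),
  I.1.8 (p. 11), I.3.3 (9) (p. 18), II.1.7 (p. 41), II.1.10 Lemma and Corollary (p. 39), II.4.3 (p. 57).
* [NeukirchANT1999] J. Neukirch, *Algebraic Number Theory* (1999), Ch. VI §1 Prop. (1.9), §5 Prop. (5.6), §7 Thm. (7.1).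
* [CasselsFrohlichANT1967] Cassels–Fröhlich (1967), Ch. VI §3.4 Thm. 3 (e), §3.7 Thm. 3; Ch. VII §5.
-/

noncomputable section

open NumberField IsDedekindDomain IsDedekindDomain.HeightOneSpectrum Field
open scoped nonZeroDivisors Classical

namespace Literature.NumberTheory.NumberFields

open Literature.NumberTheory.GaloisRepresentations
open Literature.NumberTheory.GaloisRepresentations.ArtinLocalGlobal

variable {K : Type} [Field K] [NumberField K] {𝔪 : Ideal (𝓞 K)} {v : HeightOneSpectrum (𝓞 K)}
  {a : WeilGroup (v.adicCompletion K) →* (v.adicCompletion K)ˣ}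

/-! ### §1. Inertia elements with prescribed `κ_v` -/

/-- **`a(I_{K_v}) = 𝒪_vˣ`, pointwise**: every local unit is the Artin image of an inertia element.
[cite: NeukirchANT1999, Ch. VI §5 Prop. (5.6)] [cite: CasselsFrohlichANT1967, Ch. VI §3.7 Thm. 3] -/
theorem exists_mem_inertia_artin_eq (ha : IsLocalArtinMap (v.adicCompletion K) a)
    (u : (v.adicCompletionIntegers K)ˣ) :
    ∃ w ∈ WeilGroup.inertia (v.adicCompletion K),
      a w = Units.map ((v.adicCompletionIntegers K).subtype : _ →* _) u := by
  have hu : Units.map ((v.adicCompletionIntegers K).subtype : _ →* _) u ∈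
      (ValuativeRel.valuation (v.adicCompletion K)).valuationSubring.unitGroup := by
    rw [Valuation.mem_unitGroup_iff]
    exact (ValuativeRel.isEquiv (Valued.v : Valuation (v.adicCompletion K) (WithZero (Multiplicative ℤ)))
      (ValuativeRel.valuation (v.adicCompletion K))).eq_one_iff_eq_one.mp
        (adicCompletionIntegers.isUnit_iff_valued_eq_one.mp (Units.isUnit u))
  rw [← ha.image_inertia, Subgroup.mem_map] at hu
  obtain ⟨w, hw, hwu⟩ := hu
  exact ⟨w, hw, hwu⟩

variable [IsTotallyComplex K]

/-- ★ **Every value of `κ_v` is taken on the image of the local inertia**: for `g ∈ Gal(K̄/K(𝔪))` there is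
`w ∈ I_{K_v}` with `κ_v(res w) = κ_v(g)` (de Shalit II.1.10 Corollary: `Gal(K(𝔣𝔭^∞)/K(𝔣)) ≅ 𝒪_𝔭ˣ` is the image of
the local inertia — `𝔓` is totally ramified in the `𝔭`-division tower).
[cite: deShalit1987, II.1.10 Corollary (p. 39), II.1.7 (p. 41)] [cite: NeukirchANT1999, Ch. VI §5 Prop. (5.6)] -/
theorem exists_mem_inertia_rayAdicCharacter_eq (h𝔪 : 𝔪 ≠ ⊥) (hv : ¬ 𝔪 ≤ v.asIdeal)
    (hw : ∀ u : (𝓞 K)ˣ, (u : 𝓞 K) - 1 ∈ 𝔪 → u = 1) (ha : IsLocalArtinMap (v.adicCompletion K) a)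
    (g : ↥(absRestrictNormalHom (rayClassField K 𝔪)).ker) :
    ∃ (w : WeilGroup (v.adicCompletion K)) (hwI : w ∈ WeilGroup.inertia (v.adicCompletion K)),
      rayAdicCharacter h𝔪 hv hw ⟨absGaloisRestrict K (v.adicCompletion K)
          (WeilGroup.toAbsGalois (v.adicCompletion K) w),
        absGaloisRestrict_toAbsGalois_mem_ker_rayClassField h𝔪 hv ha hwI⟩ = rayAdicCharacter h𝔪 hv hw g := by
  obtain ⟨w, hwI, hwu⟩ := exists_mem_inertia_artin_eq ha (rayAdicCharacter h𝔪 hv hw g)⁻¹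
  exact ⟨w, hwI, by rw [rayAdicCharacter_absGaloisRestrict_eq_inv h𝔪 hv hw ha hwI hwu.symm, inv_inv]⟩

/-- **Elements of `Gal(K̄/K(𝔪))` with the same `κ_v` act identically on every layer `K(𝔪vⁿ)`** (both act
through `[⟨κ_v⟩_v, K]`). [cite: deShalit1987, I.3.3 (9) (p. 18), II.1.7 (p. 41)] [cite: NeukirchANT1999, Ch. VI §7 Thm. (7.1)] -/
theorem absRestrictNormalHom_eq_of_rayAdicCharacter_eq (h𝔪 : 𝔪 ≠ ⊥) (hv : ¬ 𝔪 ≤ v.asIdeal)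
    (hw : ∀ u : (𝓞 K)ˣ, (u : 𝓞 K) - 1 ∈ 𝔪 → u = 1) {σ τ : ↥(absRestrictNormalHom (rayClassField K 𝔪)).ker}
    (h : rayAdicCharacter h𝔪 hv hw σ = rayAdicCharacter h𝔪 hv hw τ) (n : ℕ) :
    absRestrictNormalHom (rayClassField K (𝔪 * v.asIdeal ^ n)) (σ : absoluteGaloisGroup K) =
      absRestrictNormalHom (rayClassField K (𝔪 * v.asIdeal ^ n)) (τ : absoluteGaloisGroup K) := by
  rw [absRestrictNormalHom_eq_of_rayAdicCharacter h𝔪 hv hw σ n, absRestrictNormalHom_eq_of_rayAdicCharacter h𝔪 hv hw τ n, h]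

/-- ★ **The local supply for `hη`**: for every `g ∈ Gal(K̄/K(𝔪))` there is an inertia element `w ∈ I_{K_v}` such that
`res w` and `g` have the same `κ_v` AND the same restriction to every `K(𝔪vⁿ)` — `g` acts on the `𝔭`-division tower
`K(𝔪v^∞)` as the local inertia element `w`. [cite: deShalit1987, II.1.10 Corollary (p. 39), II.4.3 (p. 57)]
[cite: NeukirchANT1999, Ch. VI §5 Prop. (5.6)] -/
theorem exists_mem_inertia_forall_absRestrictNormalHom_eq (h𝔪 : 𝔪 ≠ ⊥) (hv : ¬ 𝔪 ≤ v.asIdeal)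
    (hw : ∀ u : (𝓞 K)ˣ, (u : 𝓞 K) - 1 ∈ 𝔪 → u = 1) (ha : IsLocalArtinMap (v.adicCompletion K) a)
    (g : ↥(absRestrictNormalHom (rayClassField K 𝔪)).ker) :
    ∃ (w : WeilGroup (v.adicCompletion K)) (hwI : w ∈ WeilGroup.inertia (v.adicCompletion K)),
      rayAdicCharacter h𝔪 hv hw ⟨absGaloisRestrict K (v.adicCompletion K)
          (WeilGroup.toAbsGalois (v.adicCompletion K) w),
        absGaloisRestrict_toAbsGalois_mem_ker_rayClassField h𝔪 hv ha hwI⟩ = rayAdicCharacter h𝔪 hv hw g ∧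
      ∀ n : ℕ, absRestrictNormalHom (rayClassField K (𝔪 * v.asIdeal ^ n))
          (absGaloisRestrict K (v.adicCompletion K) (WeilGroup.toAbsGalois (v.adicCompletion K) w)) =
        absRestrictNormalHom (rayClassField K (𝔪 * v.asIdeal ^ n)) (g : absoluteGaloisGroup K) := by
  obtain ⟨w, hwI, hκ⟩ := exists_mem_inertia_rayAdicCharacter_eq h𝔪 hv hw ha g
  exact ⟨w, hwI, hκ, fun n ↦ absRestrictNormalHom_eq_of_rayAdicCharacter_eq h𝔪 hv hw hκ n⟩

/-! ### §2. The Frobenius clause: `[⟨α_v⟩_v, K]` fixes `K(𝔪vⁿ)` for `(α) = 𝔭_vᵏ`, `α ≡ 1 mod 𝔪` -/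

omit [IsTotallyComplex K] in
/-- A nonzero integer is nonzero in `K_v`. [folklore] -/
private theorem algebraMap_coe_ne_zero {α : 𝓞 K} (hα0 : α ≠ 0) : ((α : K) : v.adicCompletion K) ≠ 0 := by
  rw [← algebraMap_adicCompletion_apply, map_ne_zero_iff _ (algebraMap K (v.adicCompletion K)).injective]
  exact_mod_cast hα0

/-- **`(α)⁻¹·⟨α_v⟩_v ∈ I_K^{𝔑}`** for every modulus `𝔑` agreeing with `𝔪` away from `v` (e.g. `𝔑 = 𝔪vⁿ`, `𝔑 = 𝔪`):
for `α ≠ 0`, `α − 1 ∈ 𝔪`, `α` a unit at every finite `w ≠ v`, the idele with components `α⁻¹` away from `v` and `1`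
at `v` is a unit idele `≡ 1 mod 𝔑` (Neukirch's `I_K^{𝔑}`; `K` totally complex, so no sign conditions).
[cite: NeukirchANT1999, Ch. VI §1 Prop. (1.9) (proof) p. 365] [cite: deShalit1987, I.1.8 (p. 11)] -/
theorem principalIdele_inv_mul_localUnits_mem_congruenceUnitIdeles {𝔑 : Ideal (𝓞 K)}
    (h𝔑 : ∀ w : HeightOneSpectrum (𝓞 K), w ≠ v → modulusExp 𝔑 w = modulusExp 𝔪 w) {α : 𝓞 K} (hα0 : α ≠ 0)
    (hα𝔪 : α - 1 ∈ 𝔪) (hαw : ∀ w : HeightOneSpectrum (𝓞 K), w ≠ v → α ∉ w.asIdeal) :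
    (principalIdele K (Units.mk0 (α : K) (by exact_mod_cast hα0)))⁻¹ *
        localUnits v (Units.mk0 ((α : K) : v.adicCompletion K) (algebraMap_coe_ne_zero hα0)) ∈
      congruenceUnitIdeles 𝔑 := by
  have hα : principalIdele K (Units.mk0 (α : K) (by exact_mod_cast hα0)) ∈ congruenceIdeles 𝔪 :=
    principalIdele_mem_congruenceIdeles_iff.mpr (unitsMk0_mem_rayElements_of_sub_one_mem hα0 hα𝔪)
  rw [mem_congruenceIdeles_iff] at hα
  -- the components of `y = (α)⁻¹·⟨α_v⟩_v`
  have hyv : (((principalIdele K (Units.mk0 (α : K) (by exact_mod_cast hα0)))⁻¹ *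
      localUnits v (Units.mk0 ((α : K) : v.adicCompletion K) (algebraMap_coe_ne_zero hα0)) : ideleGroup K) :
        AdeleRing (𝓞 K) K).2 v = 1 := by
    rw [ideleGroup_val_snd_mul, ideleGroup_val_inv_snd, principalIdele_snd, Units.val_mk0,
      localUnits_snd_apply_self, Units.val_mk0, algebraMap_adicCompletion_apply,
      inv_mul_cancel₀ (algebraMap_coe_ne_zero hα0)]
  have hyw : ∀ w : HeightOneSpectrum (𝓞 K), w ≠ v →
      (((principalIdele K (Units.mk0 (α : K) (by exact_mod_cast hα0)))⁻¹ *
        localUnits v (Units.mk0 ((α : K) : v.adicCompletion K) (algebraMap_coe_ne_zero hα0)) : ideleGroup K) :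
          AdeleRing (𝓞 K) K).2 w = (((α : K) : w.adicCompletion K))⁻¹ := by
    intro w hwv
    rw [ideleGroup_val_snd_mul, ideleGroup_val_inv_snd, principalIdele_snd, Units.val_mk0,
      localUnits_snd_apply_of_ne _ hwv, mul_one, algebraMap_adicCompletion_apply]
  rw [mem_congruenceUnitIdeles_iff']
  refine ⟨fun w ↦ ?_, fun w hw0 ↦ ?_, fun w hw ↦ absurd hw
    (InfinitePlace.not_isReal_iff_isComplex.mpr (IsTotallyComplex.isComplex w))⟩
  · by_cases hwv : w = v
    · subst hwv; rw [hyv, map_one]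
    · rw [hyw w hwv, map_inv₀, valued_algebraMap_eq_one_of_not_mem w (hαw w hwv), inv_one]
  · by_cases hwv : w = v
    · subst hwv; rw [hyv, sub_self, map_zero]; exact zero_le
    · rw [hyw w hwv, h𝔑 w hwv]
      have h1 := valued_algebraMap_eq_one_of_not_mem w (hαw w hwv)
      have hne : ((α : K) : w.adicCompletion K) ≠ 0 := fun h0 ↦ by rw [h0, map_zero] at h1; exact zero_ne_one h1
      have heq : (((α : K) : w.adicCompletion K))⁻¹ - 1 =
          (((α : K) : w.adicCompletion K))⁻¹ * -(((α : K) : w.adicCompletion K) - 1) := by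
        field_simp
        ring
      rw [heq, Valuation.map_mul, Valuation.map_neg, map_inv₀, h1, inv_one, one_mul,
        ← algebraMap_adicCompletion_apply, ← Units.val_mk0 (a := (α : K)) (by exact_mod_cast hα0),
        ← principalIdele_snd]
      exact hα.1 w (by rwa [h𝔑 w hwv] at hw0)

/-- ★ **THE FROBENIUS CLAUSE `[⟨α_v⟩_v, K]|_{K(𝔑)} = 1`** for every modulus `𝔑 ≠ 0` agreeing with `𝔪` away from `v`
(`𝔑 = 𝔪vⁿ`, any `n`; `𝔑 = 𝔪`): for `α ∈ 𝓞_K`, `α ≠ 0`, `α ≡ 1 mod 𝔪`, `α` a unit at every finite place `≠ v` (so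
`(α) = 𝔭_vᵏ`), the local idele `⟨α_v⟩_v` acts trivially on `K(𝔑)`: `⟨α_v⟩_v = (α)·((α)⁻¹⟨α_v⟩_v) ∈ Kˣ·W_𝔑`.
Globally this is de Shalit I.1.8's «`k_ξⁿ` is class field to `⟨ξ⟩·(1 + 𝔭ⁿ)`» with `ξ = α = φ(𝔭^f)` (the generator
`≡ 1 mod 𝔣` of `𝔭^f`): the type `ξ` of the relative Lubin–Tate group at `𝔭` is a local norm from the whole
`𝔭`-division tower `K(𝔣𝔭^∞)`. [cite: deShalit1987, I.1.8 (p. 11), II.1.10 (p. 39)]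
[cite: NeukirchANT1999, Ch. VI §1 Prop. (1.9), §7 Thm. (7.1)] -/
theorem abRestrict_ideleArtinMap_localUnits_algebraMap_eq_one {𝔑 : Ideal (𝓞 K)} (h𝔑0 : 𝔑 ≠ ⊥)
    (h𝔑 : ∀ w : HeightOneSpectrum (𝓞 K), w ≠ v → modulusExp 𝔑 w = modulusExp 𝔪 w) {α : 𝓞 K} (hα0 : α ≠ 0)
    (hα𝔪 : α - 1 ∈ 𝔪) (hαw : ∀ w : HeightOneSpectrum (𝓞 K), w ≠ v → α ∉ w.asIdeal) :
    abRestrict (rayClassField K 𝔑) (ideleArtinMap K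
      (localUnits v (Units.mk0 ((α : K) : v.adicCompletion K) (algebraMap_coe_ne_zero hα0)))) = 1 := by
  rw [abRestrict_ideleArtinMap_rayClassField_eq_one_iff]
  have hy := principalIdele_inv_mul_localUnits_mem_congruenceUnitIdeles (v := v) h𝔑 hα0 hα𝔪 hαw
  rw [← mul_inv_cancel_left (principalIdele K (Units.mk0 (α : K) (by exact_mod_cast hα0)))
    (localUnits v (Units.mk0 ((α : K) : v.adicCompletion K) (algebraMap_coe_ne_zero hα0)))]
  exact Subgroup.mul_mem_sup ⟨_, rfl⟩ (congruenceUnitIdeles_le_rayUnitIdeles h𝔑0 hy)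

/-- The Frobenius clause on the layers `K(𝔪vⁿ)` of the `v`-division tower over `K(𝔪)`.
[cite: deShalit1987, I.1.8 (p. 11)] [cite: NeukirchANT1999, Ch. VI §7 Thm. (7.1)] -/
theorem abRestrict_ideleArtinMap_localUnits_algebraMap_rayClassField_mul_pow_eq_one (h𝔪 : 𝔪 ≠ ⊥) {α : 𝓞 K}
    (hα0 : α ≠ 0) (hα𝔪 : α - 1 ∈ 𝔪) (hαw : ∀ w : HeightOneSpectrum (𝓞 K), w ≠ v → α ∉ w.asIdeal) (n : ℕ) :
    abRestrict (rayClassField K (𝔪 * v.asIdeal ^ n)) (ideleArtinMap K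
      (localUnits v (Units.mk0 ((α : K) : v.adicCompletion K) (algebraMap_coe_ne_zero hα0)))) = 1 :=
  abRestrict_ideleArtinMap_localUnits_algebraMap_eq_one (mul_ne_zero h𝔪 (pow_ne_zero _ v.ne_bot))
    (fun _ hwv ↦ modulusExp_mul_pow_of_ne h𝔪 n hwv) hα0 hα𝔪 hαw

/-! ### §3. Off inertia: `κ_v(res w) = u⁻¹` for `a(w) = α_v · u` -/

/-- **`(res w)|_{K(𝔑)} = [⟨u⁻¹⟩_v, K]|_{K(𝔑)}` when `a(w) = α_v·u`** (`α` as in §2, `𝔑` agreeing with `𝔪` away from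
`v`): local–global compatibility `(res w)|_L = ψ_L(⟨a w⟩_v)⁻¹` and the Frobenius clause kill the `α_v`-part.
[cite: NeukirchANT1999, Ch. VI §5 Prop. (5.6)] [cite: deShalit1987, II.1.7 (p. 41), I.1.8 (p. 11)] -/
theorem absRestrictNormalHom_absGaloisRestrict_eq_of_artin_eq_mul {𝔑 : Ideal (𝓞 K)} (h𝔑0 : 𝔑 ≠ ⊥)
    (h𝔑 : ∀ w : HeightOneSpectrum (𝓞 K), w ≠ v → modulusExp 𝔑 w = modulusExp 𝔪 w)
    (ha : IsLocalArtinMap (v.adicCompletion K) a) {α : 𝓞 K} (hα0 : α ≠ 0) (hα𝔪 : α - 1 ∈ 𝔪)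
    (hαw : ∀ w : HeightOneSpectrum (𝓞 K), w ≠ v → α ∉ w.asIdeal) (w : WeilGroup (v.adicCompletion K))
    {u : (v.adicCompletionIntegers K)ˣ}
    (hu : a w = Units.mk0 ((α : K) : v.adicCompletion K) (algebraMap_coe_ne_zero hα0) *
      Units.map ((v.adicCompletionIntegers K).subtype : _ →* _) u) :
    absRestrictNormalHom (rayClassField K 𝔑) (absGaloisRestrict K (v.adicCompletion K)
        (WeilGroup.toAbsGalois (v.adicCompletion K) w)) =
      abRestrict (rayClassField K 𝔑) (ideleArtinMap K
        (localUnits v (Units.map ((v.adicCompletionIntegers K).subtype : _ →* _) u⁻¹))) := by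
  haveI : NumberField (rayClassField K 𝔑) := NumberField.of_module_finite K _
  have key := artinIdeleMap_localUnits_mul_absRestrictNormalHom v (rayClassField K 𝔑) ha w
  rw [mul_eq_one_iff_inv_eq] at key
  have h1 : artinIdeleMap (rayClassField K 𝔑) artinReciprocity_character_holds
      (localUnits v (Units.mk0 ((α : K) : v.adicCompletion K) (algebraMap_coe_ne_zero hα0))) = 1 := by
    rw [← abRestrict_ideleArtinMap]
    exact abRestrict_ideleArtinMap_localUnits_algebraMap_eq_one h𝔑0 h𝔑 hα0 hα𝔪 hαw
  rw [← key, hu, map_mul, map_mul, h1, one_mul, abRestrict_ideleArtinMap, map_inv, map_inv, map_inv]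

/-- **`u⁻¹` is a `v`-adic Artin value of `res w` when `a(w) = α_v·u`.**
[cite: deShalit1987, I.3.3 (9) (p. 18), II.1.7 (p. 41)] [cite: NeukirchANT1999, Ch. VI §5 Prop. (5.6)] -/
theorem isAdicArtinValue_inv_of_artin_eq_mul (h𝔪 : 𝔪 ≠ ⊥) (ha : IsLocalArtinMap (v.adicCompletion K) a)
    {α : 𝓞 K} (hα0 : α ≠ 0) (hα𝔪 : α - 1 ∈ 𝔪) (hαw : ∀ w : HeightOneSpectrum (𝓞 K), w ≠ v → α ∉ w.asIdeal)
    (w : WeilGroup (v.adicCompletion K)) {u : (v.adicCompletionIntegers K)ˣ}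
    (hu : a w = Units.mk0 ((α : K) : v.adicCompletion K) (algebraMap_coe_ne_zero hα0) *
      Units.map ((v.adicCompletionIntegers K).subtype : _ →* _) u) :
    IsAdicArtinValue 𝔪 v (absGaloisRestrict K (v.adicCompletion K)
      (WeilGroup.toAbsGalois (v.adicCompletion K) w)) u⁻¹ :=
  fun n ↦ absRestrictNormalHom_absGaloisRestrict_eq_of_artin_eq_mul (mul_ne_zero h𝔪 (pow_ne_zero _ v.ne_bot))
    (fun _ hwv ↦ modulusExp_mul_pow_of_ne h𝔪 n hwv) ha hα0 hα𝔪 hαw w hu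

/-- **`res w ∈ Gal(K̄/K(𝔪))` when `a(w) = α_v·u`** (the `α_v`-part acts trivially on `K(𝔪)`, the unit part because
`v ∤ 𝔪`). [cite: NeukirchANT1999, Ch. VI §7 Thm. (7.1), §5 Prop. (5.6)] [cite: deShalit1987, I.1.8 (p. 11)] -/
theorem absGaloisRestrict_toAbsGalois_mem_ker_rayClassField_of_artin_eq_mul (h𝔪 : 𝔪 ≠ ⊥) (hv : ¬ 𝔪 ≤ v.asIdeal)
    (ha : IsLocalArtinMap (v.adicCompletion K) a) {α : 𝓞 K} (hα0 : α ≠ 0) (hα𝔪 : α - 1 ∈ 𝔪)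
    (hαw : ∀ w : HeightOneSpectrum (𝓞 K), w ≠ v → α ∉ w.asIdeal) (w : WeilGroup (v.adicCompletion K))
    {u : (v.adicCompletionIntegers K)ˣ}
    (hu : a w = Units.mk0 ((α : K) : v.adicCompletion K) (algebraMap_coe_ne_zero hα0) *
      Units.map ((v.adicCompletionIntegers K).subtype : _ →* _) u) :
    absGaloisRestrict K (v.adicCompletion K) (WeilGroup.toAbsGalois (v.adicCompletion K) w) ∈
      (absRestrictNormalHom (rayClassField K 𝔪)).ker := by
  rw [MonoidHom.mem_ker, absRestrictNormalHom_absGaloisRestrict_eq_of_artin_eq_mul h𝔪 (fun _ _ ↦ rfl)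
    ha hα0 hα𝔪 hαw w hu, abRestrict_ideleArtinMap_rayClassField_eq_one_iff]
  exact Subgroup.mem_sup_right (localUnits_integer_mem_rayUnitIdeles h𝔪 hv u⁻¹)

/-- ★ **OFF INERTIA: `κ_v(res w) = u⁻¹` for `a(w) = α_v·u`** (`α ∈ 𝓞_K`, `α ≠ 0`, `α ≡ 1 mod 𝔪`, `(α) = 𝔭_vᵏ`;
`u ∈ 𝒪_vˣ`) — the ray adic character on the part of the local decomposition group whose Artin image has
«uniformiser part» a power of the type: de Shalit's `κ` on `Gal(k_ξ/k)` beyond the inertia, for the type `ξ = α`.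
[cite: deShalit1987, I.1.8 (p. 11), II.1.7 (p. 41), II.1.10 (p. 39)] [cite: NeukirchANT1999, Ch. VI §5 Prop. (5.6)] -/
theorem rayAdicCharacter_absGaloisRestrict_eq_inv_of_artin_eq_mul (h𝔪 : 𝔪 ≠ ⊥) (hv : ¬ 𝔪 ≤ v.asIdeal)
    (hw : ∀ u : (𝓞 K)ˣ, (u : 𝓞 K) - 1 ∈ 𝔪 → u = 1) (ha : IsLocalArtinMap (v.adicCompletion K) a)
    {α : 𝓞 K} (hα0 : α ≠ 0) (hα𝔪 : α - 1 ∈ 𝔪) (hαw : ∀ w : HeightOneSpectrum (𝓞 K), w ≠ v → α ∉ w.asIdeal)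
    (w : WeilGroup (v.adicCompletion K)) {u : (v.adicCompletionIntegers K)ˣ}
    (hu : a w = Units.mk0 ((α : K) : v.adicCompletion K) (algebraMap_coe_ne_zero hα0) *
      Units.map ((v.adicCompletionIntegers K).subtype : _ →* _) u) :
    rayAdicCharacter h𝔪 hv hw ⟨absGaloisRestrict K (v.adicCompletion K)
        (WeilGroup.toAbsGalois (v.adicCompletion K) w),
      absGaloisRestrict_toAbsGalois_mem_ker_rayClassField_of_artin_eq_mul h𝔪 hv ha hα0 hα𝔪 hαw w hu⟩ = u⁻¹ :=
  rayAdicCharacter_eq_of_isAdicArtinValue h𝔪 hv hw (isAdicArtinValue_inv_of_artin_eq_mul h𝔪 ha hα0 hα𝔪 hαw w hu)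

/-- **`κ_v(res Φ') = 1` for a local element with `a(Φ') = α_v`** (e.g. the `f`-th power of a Frobenius of the absolute
Lubin–Tate tower of `π` with `π^f = α`): such elements fix the whole `𝔭`-division tower `K(𝔪v^∞)`.
[cite: deShalit1987, I.1.8 (p. 11), II.1.10 Corollary (p. 39)] [cite: NeukirchANT1999, Ch. VI §7 Thm. (7.1)] -/
theorem rayAdicCharacter_absGaloisRestrict_eq_one_of_artin_eq (h𝔪 : 𝔪 ≠ ⊥) (hv : ¬ 𝔪 ≤ v.asIdeal)
    (hw : ∀ u : (𝓞 K)ˣ, (u : 𝓞 K) - 1 ∈ 𝔪 → u = 1) (ha : IsLocalArtinMap (v.adicCompletion K) a)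
    {α : 𝓞 K} (hα0 : α ≠ 0) (hα𝔪 : α - 1 ∈ 𝔪) (hαw : ∀ w : HeightOneSpectrum (𝓞 K), w ≠ v → α ∉ w.asIdeal)
    (Φ : WeilGroup (v.adicCompletion K))
    (hΦ : a Φ = Units.mk0 ((α : K) : v.adicCompletion K) (algebraMap_coe_ne_zero hα0)) :
    ∃ hmem : absGaloisRestrict K (v.adicCompletion K) (WeilGroup.toAbsGalois (v.adicCompletion K) Φ) ∈
        (absRestrictNormalHom (rayClassField K 𝔪)).ker,
      rayAdicCharacter h𝔪 hv hw ⟨absGaloisRestrict K (v.adicCompletion K)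
        (WeilGroup.toAbsGalois (v.adicCompletion K) Φ), hmem⟩ = 1 := by
  have hu : a Φ = Units.mk0 ((α : K) : v.adicCompletion K) (algebraMap_coe_ne_zero hα0) *
      Units.map ((v.adicCompletionIntegers K).subtype : v.adicCompletionIntegers K →* v.adicCompletion K)
        (1 : (v.adicCompletionIntegers K)ˣ) := by
    rw [map_one, mul_one]; exact hΦ
  exact ⟨absGaloisRestrict_toAbsGalois_mem_ker_rayClassField_of_artin_eq_mul h𝔪 hv ha hα0 hα𝔪 hαw Φ hu,
    by rw [rayAdicCharacter_absGaloisRestrict_eq_inv_of_artin_eq_mul h𝔪 hv hw ha hα0 hα𝔪 hαw Φ hu, inv_one]⟩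

/-! ### §4. The Lubin–Tate junction on the decomposition group (absolute model `π^k = α`) -/

omit [IsTotallyComplex K] in
open ValuativeRel in
/-- **`χ_π(Φ) = 1` when `Art(Φ) = π`** (Cassels–Fröhlich VI §3.4 Thm. 3 (e) «`(π, K_π/K) = 1`», geometric
normalisation): an element whose Artin image is the uniformiser `π` fixes every `K_π^{n+1}` (accepted norm clause
`toAbsGalois_mem_fixingSubgroup_ltField`). [cite: CasselsFrohlichANT1967, Ch. VI §3.4 Thm. 3 (e)] -/
theorem lubinTateChar_toAbsGalois_eq_one_of_artin_eq (ha : IsLocalArtinMap (v.adicCompletion K) a)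
    {π : 𝒪[v.adicCompletion K]} (hπ : (valuation (v.adicCompletion K)).IsUniformizer (π : v.adicCompletion K))
    {Φ : WeilGroup (v.adicCompletion K)} (hΦ : a Φ = Units.mk0 (π : v.adicCompletion K) hπ.ne_zero) :
    lubinTateChar hπ (WeilGroup.toAbsGalois (v.adicCompletion K) Φ) = 1 := by
  rw [lubinTateChar_eq_one_iff]
  intro n x hx
  have h := toAbsGalois_mem_fixingSubgroup_ltField hπ ha hΦ n
  rw [Field.absoluteGaloisGroup.smul_def]
  exact (IntermediateField.mem_fixingSubgroup_iff _ _).mp h x hx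

omit [IsTotallyComplex K] in
open ValuativeRel in
/-- `χ_π(Φ^k) = 1` and `χ_π(w₁ Φ^k) = χ_π(w₁)` for `Art(Φ) = π`. [cite: CasselsFrohlichANT1967, Ch. VI §3.4 Thm. 3 (e)] -/
theorem lubinTateChar_toAbsGalois_mul_pow_eq (ha : IsLocalArtinMap (v.adicCompletion K) a)
    {π : 𝒪[v.adicCompletion K]} (hπ : (valuation (v.adicCompletion K)).IsUniformizer (π : v.adicCompletion K))
    {Φ : WeilGroup (v.adicCompletion K)} (hΦ : a Φ = Units.mk0 (π : v.adicCompletion K) hπ.ne_zero)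
    (w₁ : WeilGroup (v.adicCompletion K)) (k : ℕ) :
    lubinTateChar hπ (WeilGroup.toAbsGalois (v.adicCompletion K) (w₁ * Φ ^ k)) =
      lubinTateChar hπ (WeilGroup.toAbsGalois (v.adicCompletion K) w₁) := by
  rw [map_mul, map_pow, ← lubinTateCharHom_apply, map_mul, map_pow, lubinTateCharHom_apply, lubinTateCharHom_apply,
    lubinTateChar_toAbsGalois_eq_one_of_artin_eq ha hπ hΦ, one_pow, mul_one]

open ValuativeRel in
/-- ★ **THE JUNCTION ON THE DECOMPOSITION GROUP (absolute model)**: with THE pinned Artin map, a uniformiser `π` of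
`K_v` and a global `α ∈ 𝓞_K` with `α ≠ 0`, `α ≡ 1 mod 𝔪`, `(α) = 𝔭_vᵏ` and **`α = π^k` in `K_v`** (e.g. `π = ψ(𝔭)`,
`α = ψ(𝔭)^f` for a Grössencharacter `ψ` of conductor dividing `𝔪`): for `w = w₁·Φ^k` with `w₁ ∈ I_{K_v}` and
`Art(Φ) = π` — i.e. any element of the decomposition group above the unramified base of degree `k` —
**`κ_v(res w)⁻¹ = χ_π(w)` in `K_v`**.  With `coe_rayAdicCharacter_absGaloisRestrict_inv_eq_lubinTateChar` (the case
`k = 0`) this identifies de Shalit's `κ` with the Lubin–Tate character on all of `Gal(K̄_v/Φ)`, `Φ = K(𝔪)_𝔓`.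
[cite: deShalit1987, II.1.10 Lemma (p. 39), II.4.3 (p. 57), I.1.8 (p. 11)] [cite: LubinTate1965, Thm. 3]
[cite: CasselsFrohlichANT1967, Ch. VI §3.4 Thm. 3 (e), §3.7 Thm. 3] -/
theorem coe_rayAdicCharacter_absGaloisRestrict_mul_pow_inv_eq_lubinTateChar (h𝔪 : 𝔪 ≠ ⊥) (hv : ¬ 𝔪 ≤ v.asIdeal)
    (hw : ∀ u : (𝓞 K)ˣ, (u : 𝓞 K) - 1 ∈ 𝔪 → u = 1)
    {π : 𝒪[v.adicCompletion K]} (hπ : (valuation (v.adicCompletion K)).IsUniformizer (π : v.adicCompletion K))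
    {α : 𝓞 K} (hα0 : α ≠ 0) (hα𝔪 : α - 1 ∈ 𝔪) (hαw : ∀ w : HeightOneSpectrum (𝓞 K), w ≠ v → α ∉ w.asIdeal)
    {k : ℕ} (hαπ : ((α : K) : v.adicCompletion K) = (π : v.adicCompletion K) ^ k)
    {Φ : WeilGroup (v.adicCompletion K)}
    (hΦ : canonicalArtin (v.adicCompletion K) Φ = Units.mk0 (π : v.adicCompletion K) hπ.ne_zero)
    {w₁ : WeilGroup (v.adicCompletion K)} (hw₁ : w₁ ∈ WeilGroup.inertia (v.adicCompletion K)) :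
    ∃ hmem : absGaloisRestrict K (v.adicCompletion K) (WeilGroup.toAbsGalois (v.adicCompletion K) (w₁ * Φ ^ k)) ∈
        (absRestrictNormalHom (rayClassField K 𝔪)).ker,
      ((((rayAdicCharacter h𝔪 hv hw ⟨absGaloisRestrict K (v.adicCompletion K)
          (WeilGroup.toAbsGalois (v.adicCompletion K) (w₁ * Φ ^ k)), hmem⟩)⁻¹ :
          (v.adicCompletionIntegers K)ˣ) : v.adicCompletionIntegers K) : v.adicCompletion K) =
        (((lubinTateChar hπ (WeilGroup.toAbsGalois (v.adicCompletion K) (w₁ * Φ ^ k)) :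
          (𝒪[v.adicCompletion K])ˣ) : 𝒪[v.adicCompletion K]) : v.adicCompletion K) := by
  have ha := isLocalArtinMap_canonicalArtin_holds (v.adicCompletion K)
  -- the unit part of `Art(w₁ Φ^k) = Art(w₁) · π^k = α_v · Art(w₁)`
  obtain ⟨u, hu⟩ := exists_unitsMap_eq_artin_of_mem_inertia ha hw₁
  have hart : canonicalArtin (v.adicCompletion K) (w₁ * Φ ^ k) =
      Units.mk0 ((α : K) : v.adicCompletion K) (algebraMap_coe_ne_zero hα0) *
        Units.map ((v.adicCompletionIntegers K).subtype : _ →* _) u := by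
    rw [map_mul, map_pow, hΦ, hu, mul_comm]
    congr 1
    exact Units.ext (by rw [Units.val_pow_eq_pow_val, Units.val_mk0, Units.val_mk0, hαπ])
  refine ⟨absGaloisRestrict_toAbsGalois_mem_ker_rayClassField_of_artin_eq_mul h𝔪 hv ha hα0 hα𝔪 hαw _ hart, ?_⟩
  rw [rayAdicCharacter_absGaloisRestrict_eq_inv_of_artin_eq_mul h𝔪 hv hw ha hα0 hα𝔪 hαw _ hart, inv_inv,
    lubinTateChar_toAbsGalois_mul_pow_eq ha hπ hΦ w₁ k, coe_lubinTateChar_toAbsGalois_canonicalArtin hπ hw₁, ← hu]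
  rfl

end Literature.NumberTheory.NumberFields

end
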